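import Mathlib
import Summits.KontsevichZagierPeriods.KontsevichZagierPeriods.Theorems.SoloInformedPellAbelForm
import HarnessLib
import HarnessLib.Audit

/-!
# The circular Abel theorem for the third kind, I: the form, its potentials, boundary values

Companion of `SoloInformedPellAbelForm` (THEOREM XXX) for the **circular** packets: a *circular
Pell–Abel datum* is a unit `A + i·B·W` (`W = √Δ`, `Δ = (1−t²)(1−mt²)`, `κ = 1/W`) of norm
`A² + B²Δ = R(1−nt²)` and logarithmic derivative `i(q₀+q₂t²)κ/(1−nt²)`, whose curve runs in the
closed upper half plane from the positive real axis (`B(0) = 0 < A(0)`) to the negative one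
(`W(1) = 0`, `A(1) < 0`): total turning `π`.  The proof in `P` is substitution-free: the
straight-line homotopy `γ_v = (1−v)(1+it)⁴ + v(A + iBW)` never vanishes on `[0,1]²`, and the
angular form `(a db − b da)/(a² + b²)` pulled back to the square is `ψ = ∂_t φ = ∂_v Φ` with
`φ(0,v) = φ(1,v) = 0`, `Φ(t,0) = 4/(1+t²)`, `Φ(t,1) = (q₀+q₂t²)κ/(2(1−nt²))` (THEOREM XXXI, in
`SoloInformedPellAbelCircLaw`).  This file: the structure, the functions, `a² + b² > 0`, the two
derivative identities, the boundary values, fibrewise continuity.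
-/

noncomputable section

open MeasureTheory Set Filter
open scoped Classical

open Literature.NumberTheory.Transcendental Literature.NumberTheory.Transcendental.KZ
open Literature.ModelTheory.ExponentialFields

namespace Summit.KontsevichZagierPeriods.KontsevichZagierPeriods.Theorems

/-- A **circular Pell–Abel datum**: moduli `m, n ∈ (0,1)`, the unit `A + iB√Δ` with
`A² + B²Δ = R(1−nt²)`, its logarithmic derivative `(q₀ + q₂t²)R`, the sign pattern
`B(0) = 0 < A(0)`, `B > 0` on `(0,1)`, `A(1) < 0`, the residue condition, and the
(semi)algebraicity of all coefficients. [Abel 1826; this work] -/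
structure SoloInformedPellAbelCirc where
  /-- the modulus `m` -/
  m : ℝ
  /-- the parameter `n` of the third kind -/
  n : ℝ
  /-- constant coefficient of the residue polynomial `q` -/
  q₀ : ℝ
  /-- quadratic coefficient of the residue polynomial `q` -/
  q₂ : ℝ
  /-- the polynomial `A` -/
  A : ℝ → ℝ
  /-- its derivative -/
  A' : ℝ → ℝ
  /-- the polynomial `B` -/
  B : ℝ → ℝ
  /-- its derivative -/
  B' : ℝ → ℝ
  /-- the cofactor `R` of the norm -/
  R : ℝ → ℝ
  m_mem : m ∈ Ioo (0:ℝ) 1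
  n_mem : n ∈ Ioo (0:ℝ) 1
  m_isAlgebraic : IsAlgebraic ℚ m
  n_isAlgebraic : IsAlgebraic ℚ n
  q₀_isAlgebraic : IsAlgebraic ℚ q₀
  q₂_isAlgebraic : IsAlgebraic ℚ q₂
  hasDerivAt_A : ∀ t, HasDerivAt A (A' t) t
  hasDerivAt_B : ∀ t, HasDerivAt B (B' t) t
  continuous_A' : Continuous A'
  continuous_B' : Continuous B'
  norm : ∀ t, A t ^ 2 + B t ^ 2 * ((1 - t ^ 2) * (1 - m * t ^ 2)) = R t * (1 - n * t ^ 2)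
  num : ∀ t, 2 * (A t * B' t - A' t * B t) * ((1 - t ^ 2) * (1 - m * t ^ 2)) +
      A t * B t * (-(2 * t) * (1 - m * t ^ 2) + (1 - t ^ 2) * (-(m * (2 * t)))) =
    (q₀ + q₂ * t ^ 2) * R t
  R_pos : ∀ t, t ^ 2 ≤ 1 → 0 < R t
  A_zero : 0 < A 0
  A_one : A 1 < 0
  B_zero : B 0 = 0
  B_pos : ∀ t ∈ Ioo (0:ℝ) 1, 0 < B t
  res : q₂ + n * q₀ ≠ 0
  sa_A : ∀ ⦃S : Set (Fin 2 → ℝ)⦄, IsSemialgebraic ℚ S → ∀ i : Fin 2,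
    IsSemialgebraicFunOn ℚ S (fun w => A (w i))
  sa_A' : ∀ ⦃S : Set (Fin 2 → ℝ)⦄, IsSemialgebraic ℚ S → ∀ i : Fin 2,
    IsSemialgebraicFunOn ℚ S (fun w => A' (w i))
  sa_B : ∀ ⦃S : Set (Fin 2 → ℝ)⦄, IsSemialgebraic ℚ S → ∀ i : Fin 2,
    IsSemialgebraicFunOn ℚ S (fun w => B (w i))
  sa_B' : ∀ ⦃S : Set (Fin 2 → ℝ)⦄, IsSemialgebraic ℚ S → ∀ i : Fin 2,
    IsSemialgebraicFunOn ℚ S (fun w => B' (w i))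

namespace SoloInformedPellAbelCirc

variable (P : SoloInformedPellAbelCirc)

/-! ### The model curve `(1+it)⁴`, the homotopy, the 2-form and its potentials -/

/-- `a₀ = Re (1+it)⁴`. [this work] -/
def a₀ (t : ℝ) : ℝ := 1 - 6 * t ^ 2 + t ^ 4

/-- `a₀′`. [this work] -/
def a₀' (t : ℝ) : ℝ := -(12 * t) + 4 * t ^ 3

/-- `b₀ = Im (1+it)⁴`. [this work] -/
def b₀ (t : ℝ) : ℝ := 4 * t - 4 * t ^ 3

/-- `b₀′`. [this work] -/
def b₀' (t : ℝ) : ℝ := 4 - 12 * t ^ 2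

/-- `X = B·W`, the imaginary part of the unit. [this work] -/
def X (t : ℝ) : ℝ := P.B t * soloInformedT4W P.m t

/-- `W′/κ = −t((1−mt²) + m(1−t²))`. [this work] -/
def Wd (t : ℝ) : ℝ := -(t * ((1 - P.m * t ^ 2) + P.m * (1 - t ^ 2)))

/-- `X′` with the kernel `κ` replaced by a formal letter `k`. [this work] -/
def Xd (t k : ℝ) : ℝ := P.B' t * soloInformedT4W P.m t + P.B t * (P.Wd t * k)

/-- Real part `a = (1−v)a₀ + vA` of the homotopy. [this work] -/
def a (t v : ℝ) : ℝ := (1 - v) * a₀ t + v * P.A t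

/-- `∂_t a`. [this work] -/
def da (t v : ℝ) : ℝ := (1 - v) * a₀' t + v * P.A' t

/-- Imaginary part `b = (1−v)b₀ + vX` of the homotopy. [this work] -/
def b (t v : ℝ) : ℝ := (1 - v) * b₀ t + v * P.X t

/-- `∂_t b` (kernel letter `k`). [this work] -/
def db (t v k : ℝ) : ℝ := (1 - v) * b₀' t + v * P.Xd t k

/-- `D = a² + b² = |γ_v(t)|²`. [this work] -/
def D (t v : ℝ) : ℝ := P.a t v * P.a t v + P.b t v * P.b t v

/-- `N = a·∂_t b − b·∂_t a` (so `Φ = N/D = ∂_t arg γ_v`). [this work] -/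
def N (t v k : ℝ) : ℝ := P.a t v * P.db t v k - P.b t v * P.da t v

/-- `∂_v N`. [this work] -/
def Nv (t v k : ℝ) : ℝ :=
  (P.A t - a₀ t) * P.db t v k + P.a t v * (P.Xd t k - b₀' t) -
    ((P.X t - b₀ t) * P.da t v + P.b t v * (P.A' t - a₀' t))

/-- `∂_v D`. [this work] -/
def Dv (t v : ℝ) : ℝ := 2 * P.a t v * (P.A t - a₀ t) + 2 * P.b t v * (P.X t - b₀ t)

/-- `E = N_v·D − N·D_v` (so `ψ = E/D²`). [this work] -/
def E (t v k : ℝ) : ℝ := P.Nv t v k * P.D t v - P.N t v k * P.Dv t v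

/-- The kernel `κ(t) = 1/√((1−t²)(1−mt²))`. [folklore] -/
def kap (t : ℝ) : ℝ := (√(1 - t ^ 2))⁻¹ * (√(1 - P.m * t ^ 2))⁻¹

/-- The deformation potential `Φ(t,v) = ∂_t arg γ_v(t)`. [this work] -/
def Phi (t v : ℝ) : ℝ := P.N t v (P.kap t) / P.D t v

/-- The 2-form `ψ = ∂_v Φ = ∂_t φ` off the face `t = 1`. [this work] -/
def psiCore (t v : ℝ) : ℝ := P.E t v (P.kap t) / P.D t v ^ 2

/-- The 2-form, glued by `0` on the null face `t = 1`. [this work] -/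
def psi (t v : ℝ) : ℝ := if t < 1 then P.psiCore t v else 0

/-- The kill potential `φ(t,v) = ∂_v arg γ_v(t) = (a₀X − Ab₀)/D`. [this work] -/
def phi (t v : ℝ) : ℝ := (a₀ t * P.X t - P.A t * b₀ t) / P.D t v

/-- The end `G(t) = (q₀+q₂t²)κ/(1−nt²)` (`Φ(t,1) = G(t)/2`). [this work] -/
def G (t : ℝ) : ℝ := (P.q₀ + P.q₂ * t ^ 2) * P.kap t / (1 - P.n * t ^ 2)

/-- The constant `α = q₂/(q₂ + nq₀)`. [this work] -/
def alpha : ℝ := P.q₂ / (P.q₂ + P.n * P.q₀)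

/-- The constant `β = n/(q₂ + nq₀)`. [this work] -/
def beta : ℝ := P.n / (P.q₂ + P.n * P.q₀)

/-- **The split** `κ/(1−nt²) = ακ + 2β·(G/2)` (`t² < 1`). [this work] -/
theorem alpha_split {t : ℝ} (ht : t ^ 2 < 1) :
    P.alpha = (1 - P.beta * (P.q₀ + P.q₂ * t ^ 2)) * (1 - P.n * t ^ 2)⁻¹ := by
  have hr := P.res
  have h : 1 - P.n * t ^ 2 ≠ 0 := by nlinarith [P.n_mem.1, P.n_mem.2]
  unfold alpha beta
  field_simp
  ring

/-! ### Positivity of `D = a² + b²` on the closed square -/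

/-- A convex combination of two positive numbers is positive. [folklore] -/
theorem convex_pos {p q v : ℝ} (hp : 0 < p) (hq : 0 < q) (hv : v ∈ Icc (0:ℝ) 1) :
    0 < (1 - v) * p + v * q := by
  rcases le_total p q with h | h
  · nlinarith [mul_nonneg hv.1 (sub_nonneg.2 h), hv.2]
  · nlinarith [mul_nonneg (sub_nonneg.2 hv.2) (sub_nonneg.2 h), hv.1]

/-- `X = BW > 0` on `(0,1)`. [this work] -/
theorem X_pos {t : ℝ} (ht : t ∈ Ioo (0:ℝ) 1) : 0 < P.X t := by
  have ht2 : t ^ 2 < 1 := by nlinarith [ht.1, ht.2]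
  obtain ⟨h1, h2⟩ := soloInformed_kummerZeta_radicands_pos P.m_mem ht2
  unfold X
  rw [soloInformed_t4_W_eq_sqrt]
  exact mul_pos (P.B_pos t ht) (mul_pos (Real.sqrt_pos.2 h1) (Real.sqrt_pos.2 h2))

/-- Values of the homotopy at the two ends `v = 0, 1`. [this work] -/
theorem ends (t k : ℝ) : P.a t 0 = a₀ t ∧ P.b t 0 = b₀ t ∧ P.da t 0 = a₀' t ∧ P.db t 0 k = b₀' t ∧
    P.a t 1 = P.A t ∧ P.b t 1 = P.X t ∧ P.da t 1 = P.A' t ∧ P.db t 1 k = P.Xd t k := by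
  refine ⟨?_, ?_, ?_, ?_, ?_, ?_, ?_, ?_⟩ <;> simp [a, b, da, db]

/-- **`D = |γ_v(t)|² > 0` on `[0,1]²`**: `b > 0` inside, `a > 0` on `t = 0`, `a < 0` on `t = 1`.
[this work] -/
theorem D_pos {t v : ℝ} (ht : t ∈ Icc (0:ℝ) 1) (hv : v ∈ Icc (0:ℝ) 1) : 0 < P.D t v := by
  unfold D
  rcases eq_or_lt_of_le ht.1 with h0 | h0
  · have e : P.a 0 v = (1 - v) * 1 + v * P.A 0 := by unfold a a₀; ring
    have ha : 0 < P.a t v := by rw [← h0, e]; exact convex_pos one_pos P.A_zero hv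
    nlinarith [mul_self_nonneg (P.b t v), mul_pos ha ha]
  · rcases eq_or_lt_of_le ht.2 with h1 | h1
    · have e : P.a 1 v = -((1 - v) * 4 + v * (-P.A 1)) := by unfold a a₀; ring
      have ha : P.a t v < 0 := by
        rw [h1, e]
        linarith [convex_pos (by norm_num : (0:ℝ) < 4) (neg_pos.2 P.A_one) hv]
      nlinarith [mul_self_nonneg (P.b t v), mul_pos (neg_pos.2 ha) (neg_pos.2 ha)]
    · have ht2 : t ^ 2 < 1 := by nlinarith
      have hb0 : 0 < b₀ t := by unfold b₀; nlinarith [mul_pos h0 (sub_pos.2 ht2)]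
      have hb : 0 < P.b t v := by unfold b; exact convex_pos hb0 (P.X_pos ⟨h0, h1⟩) hv
      nlinarith [mul_self_nonneg (P.a t v), mul_pos hb hb]

/-! ### The two derivative identities -/

/-- `d/dv ((1−v)p + vq) = q − p`. [folklore] -/
theorem hasDerivAt_affine (p q v : ℝ) : HasDerivAt (fun v : ℝ => (1 - v) * p + v * q) (q - p) v := by
  have h := (((hasDerivAt_id' v).const_sub 1).mul_const p).add ((hasDerivAt_id' v).mul_const q)
  refine h.congr_deriv ?_
  ring

/-- `a₀′` is the derivative of `a₀`. [folklore] -/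
theorem a₀_hasDerivAt (t : ℝ) : HasDerivAt a₀ (a₀' t) t := by
  have e : a₀ = fun t => 1 - 6 * t ^ 2 + t ^ 2 * t ^ 2 := funext fun t => by unfold a₀; ring
  rw [e]
  have h := (((soloInformed_hasDerivAt_sq t).const_mul 6).const_sub 1).add
    ((soloInformed_hasDerivAt_sq t).mul (soloInformed_hasDerivAt_sq t))
  refine h.congr_deriv ?_
  unfold a₀'
  ring

/-- `b₀′` is the derivative of `b₀`. [folklore] -/
theorem b₀_hasDerivAt (t : ℝ) : HasDerivAt b₀ (b₀' t) t := by
  have e : b₀ = fun t => 4 * t - 4 * (t * t ^ 2) := funext fun t => by unfold b₀; ring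
  rw [e]
  have h := ((hasDerivAt_id' t).const_mul 4).sub
    (((hasDerivAt_id' t).mul (soloInformed_hasDerivAt_sq t)).const_mul 4)
  refine h.congr_deriv ?_
  unfold b₀'
  ring

/-- `∂_t X = X_d(t, κ(t))` for `t² < 1`. [this work] -/
theorem X_hasDerivAt {t : ℝ} (ht : t ^ 2 < 1) : HasDerivAt (fun t => P.X t) (P.Xd t (P.kap t)) t := by
  unfold X Xd Wd kap
  exact (P.hasDerivAt_B t).mul (soloInformed_t4_W_hasDerivAt P.m_mem ht)

/-- `ψ = ψ_core` off the face `t = 1`. [this work] -/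
theorem psi_eq {t : ℝ} (ht : t < 1) (v : ℝ) : P.psi t v = P.psiCore t v := by
  simp [psi, ht]

/-- **`∂_t φ = ψ`** for `t ∈ [0,1)`, `v ∈ [0,1]`: closedness of the angular form. [this work] -/
theorem phi_hasDerivAt {t v : ℝ} (ht : t ∈ Ico (0:ℝ) 1) (hv : v ∈ Icc (0:ℝ) 1) :
    HasDerivAt (fun t => P.phi t v) (P.psi t v) t := by
  have ht2 : t ^ 2 < 1 := by nlinarith [ht.1, ht.2]
  have hD0 := (P.D_pos ⟨ht.1, ht.2.le⟩ hv).ne'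
  have hX := P.X_hasDerivAt ht2
  have hA := P.hasDerivAt_A t
  have ha : HasDerivAt (fun t => P.a t v) (P.da t v) t := by
    unfold a da
    exact ((a₀_hasDerivAt t).const_mul (1 - v)).add (hA.const_mul v)
  have hb : HasDerivAt (fun t => P.b t v) (P.db t v (P.kap t)) t := by
    unfold b db
    exact ((b₀_hasDerivAt t).const_mul (1 - v)).add (hX.const_mul v)
  have hDd : HasDerivAt (fun t => P.D t v) (P.da t v * P.a t v + P.a t v * P.da t v +
      (P.db t v (P.kap t) * P.b t v + P.b t v * P.db t v (P.kap t))) t := by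
    unfold D
    exact (ha.mul ha).add (hb.mul hb)
  have hM : HasDerivAt (fun t => a₀ t * P.X t - P.A t * b₀ t)
      (a₀' t * P.X t + a₀ t * P.Xd t (P.kap t) - (P.A' t * b₀ t + P.A t * b₀' t)) t :=
    ((a₀_hasDerivAt t).mul hX).sub (hA.mul (b₀_hasDerivAt t))
  rw [P.psi_eq ht.2]
  unfold phi
  refine (hM.div hDd hD0).congr_deriv ?_
  unfold psiCore E Nv N Dv D a b da db
  ring

/-- **`∂_v Φ = ψ`** for `t ∈ [0,1)`, `v ∈ [0,1]`. [this work] -/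
theorem Phi_hasDerivAt {t v : ℝ} (ht : t ∈ Ico (0:ℝ) 1) (hv : v ∈ Icc (0:ℝ) 1) :
    HasDerivAt (fun v => P.Phi t v) (P.psi t v) v := by
  have hD0 := (P.D_pos ⟨ht.1, ht.2.le⟩ hv).ne'
  have ha : HasDerivAt (fun v => P.a t v) (P.A t - a₀ t) v := hasDerivAt_affine _ _ v
  have hda : HasDerivAt (fun v => P.da t v) (P.A' t - a₀' t) v := hasDerivAt_affine _ _ v
  have hb : HasDerivAt (fun v => P.b t v) (P.X t - b₀ t) v := hasDerivAt_affine _ _ v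
  have hdb : HasDerivAt (fun v => P.db t v (P.kap t)) (P.Xd t (P.kap t) - b₀' t) v :=
    hasDerivAt_affine _ _ v
  have hN : HasDerivAt (fun v => P.N t v (P.kap t)) ((P.A t - a₀ t) * P.db t v (P.kap t) +
      P.a t v * (P.Xd t (P.kap t) - b₀' t) - ((P.X t - b₀ t) * P.da t v +
        P.b t v * (P.A' t - a₀' t))) v := by
    unfold N
    exact (ha.mul hdb).sub (hb.mul hda)
  have hDd : HasDerivAt (fun v => P.D t v) ((P.A t - a₀ t) * P.a t v + P.a t v * (P.A t - a₀ t) +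
      ((P.X t - b₀ t) * P.b t v + P.b t v * (P.X t - b₀ t))) v := by
    unfold D
    exact (ha.mul ha).add (hb.mul hb)
  rw [P.psi_eq ht.2]
  unfold Phi
  refine (hN.div hDd hD0).congr_deriv ?_
  unfold psiCore E Nv Dv
  ring

/-! ### Boundary values -/

/-- **The faces**: `φ(0,v) = 0` (`B(0) = 0 = b₀(0)`), `φ(1,v) = 0` (`W(1) = 0 = b₀(1)`),
`ψ(1,v) = 0` (glued). [this work] -/
theorem faces (v : ℝ) : P.phi 0 v = 0 ∧ P.phi 1 v = 0 ∧ P.psi 1 v = 0 := by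
  have h : b₀ 1 = 0 := by unfold b₀; norm_num
  refine ⟨by simp [phi, X, b₀, P.B_zero], by simp [phi, X, h, soloInformed_t4_W_one], by simp [psi]⟩

/-- **The model end** `Φ(t,0) = 4/(1+t²)` (`a₀b₀′ − b₀a₀′ = 4(1+t²)³`, `a₀² + b₀² = (1+t²)⁴`).
[this work] -/
theorem Phi_zero (t : ℝ) : P.Phi t 0 = 4 / (1 + t ^ 2) := by
  have h1 : P.N t 0 (P.kap t) = 4 * (1 + t ^ 2) ^ 3 := by
    unfold N a b da db a₀ b₀ a₀' b₀'; ring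
  have h2 : P.D t 0 = (1 + t ^ 2) ^ 4 := by
    unfold D a b a₀ b₀; ring
  have h3 : (1 + t ^ 2) ≠ 0 := by positivity
  unfold Phi
  rw [h1, h2]
  field_simp

/-- `N(t,1) = (q₀+q₂t²)Rκ/2`: the logarithmic derivative of the unit. [this work] -/
theorem N_one (t : ℝ) : P.N t 1 (P.kap t) = (P.q₀ + P.q₂ * t ^ 2) * P.R t * P.kap t / 2 := by
  have key := P.num t
  obtain ⟨-, -, -, -, ha, hb, hda, hdb⟩ := P.ends t (P.kap t)
  unfold N
  rw [ha, hb, hda, hdb]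
  unfold Xd X Wd kap soloInformedT4W
  linear_combination ((√(1 - t ^ 2))⁻¹ * (√(1 - P.m * t ^ 2))⁻¹ / 2) * key

/-- `D(t,1) = A² + B²Δ = R(1−nt²)` for `t² < 1`. [this work] -/
theorem D_one {t : ℝ} (ht : t ^ 2 < 1) : P.D t 1 = P.R t * (1 - P.n * t ^ 2) := by
  have hW := soloInformed_t4_W_sq P.m_mem ht
  have hN := P.norm t
  obtain ⟨-, -, -, -, ha, hb, -, -⟩ := P.ends t 0
  unfold D
  rw [ha, hb, ← hN]
  unfold X
  rw [← hW]
  ring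

/-- **The unit's end** `Φ(t,1) = G(t)/2` for `t² < 1`. [this work] -/
theorem Phi_one {t : ℝ} (ht : t ^ 2 < 1) : P.Phi t 1 = P.G t / 2 := by
  have hR := (P.R_pos t ht.le).ne'
  have h1n : 1 - P.n * t ^ 2 ≠ 0 := by nlinarith [P.n_mem.1, P.n_mem.2]
  unfold Phi G
  rw [P.N_one, P.D_one ht]
  field_simp

/-- `A`, `B` and `W` are continuous. [folklore] -/
theorem continuous_ABW : Continuous P.A ∧ Continuous P.B ∧ Continuous (soloInformedT4W P.m) :=
  ⟨continuous_iff_continuousAt.2 fun t => (P.hasDerivAt_A t).continuousAt,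
    continuous_iff_continuousAt.2 fun t => (P.hasDerivAt_B t).continuousAt,
    SoloInformedPellAbel.W_continuous P.m⟩

/-- `(t,v) ↦ D(t,v)` is continuous. [folklore] -/
theorem continuous_D : Continuous fun p : ℝ × ℝ => P.D p.1 p.2 := by
  obtain ⟨hA, hB, hW⟩ := P.continuous_ABW
  unfold D a b a₀ b₀ X
  fun_prop

/-- **Fibrewise continuity of the potentials**: `φ(·,v)` and `Φ(t,·)` are continuous on `[0,1]`
(`t, v ∈ [0,1]`). [this work] -/
theorem continuousOn_potentials {t v : ℝ} (ht : t ∈ Icc (0:ℝ) 1) (hv : v ∈ Icc (0:ℝ) 1) :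
    ContinuousOn (fun s => P.phi s v) (Icc 0 1) ∧ ContinuousOn (fun u => P.Phi t u) (Icc 0 1) := by
  obtain ⟨hA, hB, hW⟩ := P.continuous_ABW
  have hD : Continuous fun s => P.D s v :=
    P.continuous_D.comp (continuous_id.prodMk continuous_const)
  have hD' : Continuous fun u => P.D t u :=
    P.continuous_D.comp (continuous_const.prodMk continuous_id)
  refine ⟨?_, ?_⟩
  · unfold phi
    refine ContinuousOn.div (Continuous.continuousOn ?_) hD.continuousOn
      fun s hs => (P.D_pos hs hv).ne'
    unfold a₀ b₀ X
    fun_prop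
  · unfold Phi
    refine ContinuousOn.div (Continuous.continuousOn ?_) hD'.continuousOn
      fun u hu => (P.D_pos ht hu).ne'
    unfold N a b da db
    fun_prop

end SoloInformedPellAbelCirc

end Summit.KontsevichZagierPeriods.KontsevichZagierPeriods.Theorems

end
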